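import Summits.QuantumAdvantage.QuantumAdvantage.Theorems.SosSandwichPseudoBoundedAALevelOneRung
import Literature.Computability.Complexity.FourierDegreeAlgebra
import HarnessLib

/-!
# Route `SosSandwich`, crux `PseudoBoundedAA` (stmt-QuantumAdvantage-15237): level-two tools — sup norm of the
# level-2 part and DECOUPLING

Part 1 of the LEVEL-TWO RUNG of the AA ladder (part 2: `Theorems/SosSandwichPseudoBoundedAALevelTwoRung.lean`;
level `1`: `Theorems/SosSandwichPseudoBoundedAALevelOneRung.lean`).  For an `M`-bounded function `g` on the cube
`{0,1}^N` of Fourier degree `≤ d`: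

* §1 `abs_levelTwo_sum_le` — **sup norm of the level-2 part**: `|Σ_{|S|=2} ĝ(S) χ_S(s)| ≤ d³M/2` for every
  sign pattern `s` (the second coefficient of the noise polynomial `P_s(t) = Σ_S t^{|S|} ĝ(S) χ_S(s)`:
  Markov's inequality for `P_s'`, then Bernstein's at the interior point `0`; tree `markov_inequality`,
  `bernstein_inequality`, Korneichuk Thm. 3.5.8 / Prop. 3.5.7).
* §2 `abs_levelTwo_sum_subset_le` — the level-2 part RESTRICTED to the pairs inside any `A ⊆ [N]` obeys the
  same bound (it is the average of the level-2 part over the coordinates outside `A`, O'Donnell Prop. 3.21);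
  `bilinear_eq` / `abs_bilinear_le` — DECOUPLING by polarization:
  `Σ_i Σ_{k≠i} ĝ({i,k}) χ_i(x) χ_k(y) = 2·Σ_{S ⊆ {x=y}, |S|=2} ĝ(S)χ_S(x) − 2·Σ_{S ⊆ {x≠y}, |S|=2} ĝ(S)χ_S(x)`,
  hence `|Σ_i Σ_{k≠i} ĝ({i,k}) χ_i(x) χ_k(y)| ≤ 4L` whenever the level-2 part is `L`-bounded;
  `sum_abs_row_le` — consequently the ROW SUMS are uniformly bounded: `Σ_i |Σ_{k≠i} ĝ({i,k}) χ_k(u)| ≤ 4L`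
  for every `u` (take `x` = the signs of the rows).

Honest label: support lemmas (tools for a new rung); no stub, crux or summit is proved.  Sources: Korneichuk
1991 §3.5.4; O'Donnell 2014 §1.4, §3.3; Littlewood 1930 (mixed-norm inequality, first step).
-/

-- D-0017: single-conjunct summit ⇒ the duplicate `QuantumAdvantage.QuantumAdvantage` is mandated.
set_option linter.dupNamespace false

noncomputable section

namespace Summit.QuantumAdvantage.QuantumAdvantage.Theorems.SosSandwich.LevelTwoRung

open Finset
open Literature.Computability.QuantumComplexity
open Literature.Computability.Complexity.LowDegree (cubeFourierCoeff sum_cubeFourierCoeff_mul_walsh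
  sum_walsh_mul_walsh_index IsLevelLE isLevelLE_walsh)
open Literature.Probability.RandomGraphs.LowDegree (sgn walsh sgn_true sgn_false walsh_empty)
open Summit.QuantumAdvantage.QuantumAdvantage.Theorems.SosSandwich.LevelOneRung

variable {N : ℕ}

/-! ### §1 The second coefficient of the noise polynomial: `|Σ_{|S|=2} ĝ(S) χ_S(s)| ≤ d³M/2` -/

/-- The coefficients of the noise polynomial: `[t^k] P_s = Σ_{|S| = k} ĝ(S) χ_S(s)`. [folklore] -/
theorem coeff_noisePoly (g : (Fin N → Bool) → ℝ) (s : Fin N → Bool) (k : ℕ) :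
    (∑ S : Finset (Fin N), Polynomial.C (cubeFourierCoeff g S * walsh S s) * Polynomial.X ^ S.card).coeff k =
      ∑ S ∈ univ.filter (fun S : Finset (Fin N) => S.card = k), cubeFourierCoeff g S * walsh S s := by
  rw [Polynomial.finsetSum_coeff, Finset.sum_filter]
  refine Finset.sum_congr rfl fun S _ => ?_
  rw [Polynomial.coeff_C_mul_X_pow]
  by_cases h : S.card = k
  · rw [if_pos h.symm, if_pos h]
  · rw [if_neg (fun h' => h h'.symm), if_neg h]

/-- The second derivative of the noise polynomial at `0` is twice the level-2 sum. [folklore] -/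
theorem eval_zero_derivative_two_noisePoly (g : (Fin N → Bool) → ℝ) (s : Fin N → Bool) :
    (Polynomial.derivative (Polynomial.derivative (∑ S : Finset (Fin N),
        Polynomial.C (cubeFourierCoeff g S * walsh S s) * Polynomial.X ^ S.card))).eval 0 =
      2 * ∑ S ∈ univ.filter (fun S : Finset (Fin N) => S.card = 2), cubeFourierCoeff g S * walsh S s := by
  rw [← Polynomial.coeff_zero_eq_eval_zero, Polynomial.coeff_derivative, Polynomial.coeff_derivative,
    coeff_noisePoly]
  norm_num
  ring

/-- Markov's inequality for the noise polynomial: `|P_s'(y)| ≤ d²M` on `[-1, 1]`. [cite: Korneichuk1991, Thm 3.5.8 (§3.5.4)] -/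
theorem abs_eval_derivative_noisePoly_le {d : ℕ} {M : ℝ} {g : (Fin N → Bool) → ℝ} (hdeg : IsLevelLE d g)
    (hM : ∀ x, |g x| ≤ M) (s : Fin N → Bool) {y : ℝ} (hy : y ∈ Set.Icc (-1 : ℝ) 1) :
    |(Polynomial.derivative (∑ S : Finset (Fin N),
        Polynomial.C (cubeFourierCoeff g S * walsh S s) * Polynomial.X ^ S.card)).eval y| ≤ (d : ℝ) ^ 2 * M :=
  Literature.Analysis.Approximation.markov_inequality (degree_noisePoly_le hdeg s)
    (fun _ hz => abs_eval_noisePoly_le hM s hz) hy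

/-- **Sup norm of the level-2 part**: `|Σ_{|S|=2} ĝ(S) χ_S(s)| ≤ d³M/2` for an `M`-bounded `g` of Fourier
degree `≤ d` and every sign pattern `s` (Bernstein at `0` for `P_s'`, which is `d²M`-bounded by Markov).
[cite: Korneichuk1991, Prop 3.5.7 and Thm 3.5.8 (§3.5.4)] [cite: ODonnell2014, §2.4] -/
theorem abs_levelTwo_sum_le {d : ℕ} {M : ℝ} {g : (Fin N → Bool) → ℝ} (hdeg : IsLevelLE d g)
    (hM : ∀ x, |g x| ≤ M) (s : Fin N → Bool) :
    |∑ S ∈ univ.filter (fun S : Finset (Fin N) => S.card = 2), cubeFourierCoeff g S * walsh S s|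
      ≤ (d : ℝ) ^ 3 * M / 2 := by
  set P : Polynomial ℝ := ∑ S : Finset (Fin N),
    Polynomial.C (cubeFourierCoeff g S * walsh S s) * Polynomial.X ^ S.card with hP
  have hdegP' : (Polynomial.derivative P).degree ≤ (d : WithBot ℕ) :=
    Polynomial.degree_derivative_le.trans (degree_noisePoly_le hdeg s)
  have h := Literature.Analysis.Approximation.bernstein_inequality hdegP'
    (fun _ hy => abs_eval_derivative_noisePoly_le hdeg hM s hy) (x := 0) ⟨by norm_num, by norm_num⟩
  rw [eval_zero_derivative_two_noisePoly] at h
  have h2 : |2 * ∑ S ∈ univ.filter (fun S : Finset (Fin N) => S.card = 2), cubeFourierCoeff g S * walsh S s|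
      ≤ d * ((d : ℝ) ^ 2 * M) := by simpa using h
  rw [abs_mul, abs_two] at h2
  nlinarith [h2]

/-! ### §2 Restricted level-2 sums and decoupling -/

/-- `Σ_u χ_T(u) = 2^N [T = ∅]`. [cite: ODonnell2014, §1.4] -/
theorem sum_walsh_eq_ite (T : Finset (Fin N)) :
    ∑ u : Fin N → Bool, walsh T u = if T = ∅ then (2 : ℝ) ^ N else 0 := by
  have h := sum_walsh_mul_walsh_index T (∅ : Finset (Fin N))
  simp only [walsh_empty, mul_one] at h
  exact h

/-- Averaging the coordinates outside `A` kills every character not supported inside `A`: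
`Σ_u χ_S(x on A, u off A) = 2^N χ_S(x) [S ⊆ A]`. [cite: ODonnell2014, §3.3 (Prop. 3.21)] -/
theorem sum_walsh_piecewise (S A : Finset (Fin N)) (x : Fin N → Bool) :
    ∑ u : Fin N → Bool, walsh S (A.piecewise x u) = if S ⊆ A then (2 : ℝ) ^ N * walsh S x else 0 := by
  simp_rw [Literature.Computability.Complexity.LowDegree.walsh_piecewise S A x]
  rw [← Finset.mul_sum, sum_walsh_eq_ite]
  by_cases hS : S ⊆ A
  · have h1 : S.filter (· ∉ A) = ∅ := Finset.filter_eq_empty_iff.mpr fun i hi h => h (hS hi)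
    have h2 : S.filter (· ∈ A) = S := Finset.filter_true_of_mem fun i hi => hS hi
    rw [if_pos hS, h1, if_pos rfl, h2, mul_comm]
    rfl
  · have h1 : S.filter (· ∉ A) ≠ ∅ := by
      intro h
      apply hS
      intro i hi
      by_contra hiA
      have : i ∈ S.filter (· ∉ A) := Finset.mem_filter.mpr ⟨hi, hiA⟩
      rw [h] at this
      simp at this
    rw [if_neg hS, if_neg h1, mul_zero]

/-- The pairs inside `A`: `(univ.filter (|·| = 2)).filter (· ⊆ A) = A.powersetCard 2`. [folklore] -/
theorem filter_card_two_subset (A : Finset (Fin N)) :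
    (univ.filter (fun S : Finset (Fin N) => S.card = 2)).filter (fun S => S ⊆ A) = A.powersetCard 2 := by
  ext S
  simp only [Finset.mem_filter, Finset.mem_univ, true_and, Finset.mem_powersetCard]
  tauto

/-- **The level-2 part restricted to the pairs inside `A` is the average of the level-2 part over the
coordinates outside `A`**: `Σ_{S ⊆ A, |S| = 2} ĝ(S) χ_S(x) = E_u Σ_{|S|=2} ĝ(S) χ_S(x on A, u off A)`.
[cite: ODonnell2014, §3.3 (Prop. 3.21)] -/
theorem levelTwo_sum_subset_eq_avg (g : (Fin N → Bool) → ℝ) (A : Finset (Fin N)) (x : Fin N → Bool) :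
    ∑ S ∈ A.powersetCard 2, cubeFourierCoeff g S * walsh S x =
      (∑ u : Fin N → Bool, ∑ S ∈ univ.filter (fun S : Finset (Fin N) => S.card = 2),
        cubeFourierCoeff g S * walsh S (A.piecewise x u)) / (2 : ℝ) ^ N := by
  rw [Finset.sum_comm]
  simp_rw [← Finset.mul_sum, sum_walsh_piecewise]
  rw [eq_div_iff (by positivity), ← filter_card_two_subset, Finset.sum_filter, Finset.sum_mul]
  refine Finset.sum_congr rfl fun S _ => ?_
  split_ifs <;> ring

/-- A bound on the level-2 part passes to its restrictions to the pairs inside any `A`. [cite: ODonnell2014, §3.3] -/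
theorem abs_levelTwo_sum_subset_le {L : ℝ} {g : (Fin N → Bool) → ℝ}
    (hL : ∀ z : Fin N → Bool,
      |∑ S ∈ univ.filter (fun S : Finset (Fin N) => S.card = 2), cubeFourierCoeff g S * walsh S z| ≤ L)
    (A : Finset (Fin N)) (x : Fin N → Bool) :
    |∑ S ∈ A.powersetCard 2, cubeFourierCoeff g S * walsh S x| ≤ L := by
  rw [levelTwo_sum_subset_eq_avg, abs_div, abs_of_pos (by positivity : (0 : ℝ) < (2 : ℝ) ^ N),
    div_le_iff₀ (by positivity)]
  calc |∑ u : Fin N → Bool, ∑ S ∈ univ.filter (fun S : Finset (Fin N) => S.card = 2),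
          cubeFourierCoeff g S * walsh S (A.piecewise x u)|
      ≤ ∑ u : Fin N → Bool, |∑ S ∈ univ.filter (fun S : Finset (Fin N) => S.card = 2),
          cubeFourierCoeff g S * walsh S (A.piecewise x u)| := Finset.abs_sum_le_sum_abs _ _
    _ ≤ ∑ _u : Fin N → Bool, L := Finset.sum_le_sum fun u _ => hL _
    _ = L * (2 : ℝ) ^ N := by simp [Finset.card_univ, Fintype.card_fin, mul_comm]

/-- The size-2 subsets of `A` containing `i ∈ A` are the `{i, k}`, `k ∈ A ∖ {i}`; summed. [folklore] -/
theorem sum_powersetCard_two_containing (A : Finset (Fin N)) {i : Fin N} (hi : i ∈ A)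
    (F : Finset (Fin N) → ℝ) :
    ∑ S ∈ (A.powersetCard 2).filter (fun S => i ∈ S), F S = ∑ k ∈ A.erase i, F {i, k} := by
  classical
  have himg : (A.erase i).image (fun k => ({i, k} : Finset (Fin N))) =
      (A.powersetCard 2).filter (fun S => i ∈ S) := by
    ext S
    simp only [Finset.mem_image, Finset.mem_erase, Finset.mem_filter, Finset.mem_powersetCard]
    constructor
    · rintro ⟨k, ⟨hk, hkA⟩, rfl⟩
      refine ⟨⟨?_, Finset.card_pair (Ne.symm hk)⟩, by simp⟩
      intro j hj
      rw [Finset.mem_insert, Finset.mem_singleton] at hj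
      rcases hj with rfl | rfl
      · exact hi
      · exact hkA
    · rintro ⟨⟨hSA, h2⟩, hiS⟩
      obtain ⟨a, b, hab, rfl⟩ := Finset.card_eq_two.mp h2
      rw [Finset.mem_insert, Finset.mem_singleton] at hiS
      rcases hiS with rfl | rfl
      · exact ⟨b, ⟨hab.symm, hSA (by simp)⟩, rfl⟩
      · exact ⟨a, ⟨hab, hSA (by simp)⟩, Finset.pair_comm i a⟩
  rw [← himg, Finset.sum_image]
  intro a ha b hb hab
  have ha' : a ≠ i := (Finset.mem_erase.mp ha).1
  have hab' : ({i, a} : Finset (Fin N)) = {i, b} := hab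
  have hmem : a ∈ ({i, b} : Finset (Fin N)) := by rw [← hab']; simp
  rw [Finset.mem_insert, Finset.mem_singleton] at hmem
  rcases hmem with h | h
  · exact absurd h ha'
  · exact h

/-- Double counting inside `A`: `Σ_{i ∈ A} Σ_{k ∈ A ∖ {i}} F({i,k}) = 2 Σ_{S ⊆ A, |S| = 2} F(S)`. [folklore] -/
theorem sum_sum_erase_pair (A : Finset (Fin N)) (F : Finset (Fin N) → ℝ) :
    ∑ i ∈ A, ∑ k ∈ A.erase i, F {i, k} = 2 * ∑ S ∈ A.powersetCard 2, F S := by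
  classical
  have e1 : ∀ i ∈ A, ∑ k ∈ A.erase i, F {i, k} =
      ∑ S ∈ A.powersetCard 2, (if i ∈ S then F S else 0) := by
    intro i hi
    rw [← sum_powersetCard_two_containing A hi, Finset.sum_filter]
  rw [Finset.sum_congr rfl e1, Finset.sum_comm, Finset.mul_sum]
  refine Finset.sum_congr rfl fun S hS => ?_
  rw [Finset.mem_powersetCard] at hS
  rw [← Finset.sum_filter, Finset.filter_mem_eq_inter, Finset.inter_eq_right.mpr hS.1, Finset.sum_const,
    hS.2, nsmul_eq_mul]
  norm_num

/-- A character of a pair: `χ_{{i,k}}(x) = χ_i(x) χ_k(x)` for `i ≠ k`. [cite: ODonnell2014, §1.2] -/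
theorem walsh_pair {i k : Fin N} (h : i ≠ k) (x : Fin N → Bool) :
    walsh {i, k} x = sgn (x i) * sgn (x k) := by
  rw [walsh, Finset.prod_pair h]

/-- A flipped sign: `χ(y_k) = -χ(x_k)` when `x_k ≠ y_k`, `= χ(x_k)` when `x_k = y_k`. [folklore] -/
theorem sgn_eq_ite_mul (a b : Bool) : sgn b = (if a = b then 1 else -1) * sgn a := by
  cases a <;> cases b <;> simp [sgn]

/-- **Decoupling by polarization.**  For all sign patterns `x, y`, with `J = {k : x_k ≠ y_k}`:
`Σ_i Σ_{k ≠ i} ĝ({i,k}) χ_i(x) χ_k(y) = 2·Σ_{S ⊆ Jᶜ, |S|=2} ĝ(S) χ_S(x) − 2·Σ_{S ⊆ J, |S|=2} ĝ(S) χ_S(x)`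
(`B(x,y) = Q(z) - Q(z')` for the agreement part `z` and the disagreement part `z'`). [folklore] -/
theorem bilinear_eq (g : (Fin N → Bool) → ℝ) (x y : Fin N → Bool) :
    ∑ i, ∑ k ∈ univ.erase i, cubeFourierCoeff g {i, k} * sgn (x i) * sgn (y k) =
      2 * ∑ S ∈ (univ.filter (fun k : Fin N => x k = y k)).powersetCard 2, cubeFourierCoeff g S * walsh S x -
      2 * ∑ S ∈ (univ.filter (fun k : Fin N => x k ≠ y k)).powersetCard 2, cubeFourierCoeff g S * walsh S x := by
  classical
  -- the symmetric kernel `c i k = ĝ({i,k}) χ_i(x) χ_k(x)` and the signs `ε k = ±1`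
  set ε : Fin N → ℝ := fun k => if x k = y k then 1 else -1 with hε
  set c : Fin N → Fin N → ℝ := fun i k => cubeFourierCoeff g {i, k} * sgn (x i) * sgn (x k) with hc
  have hsymm : ∀ i k, c i k = c k i := fun i k => by
    simp only [hc, Finset.pair_comm i k]; ring
  have hLHS : ∑ i, ∑ k ∈ univ.erase i, cubeFourierCoeff g {i, k} * sgn (x i) * sgn (y k) =
      ∑ i, ∑ k ∈ univ.erase i, c i k * ε k := by
    refine Finset.sum_congr rfl fun i _ => Finset.sum_congr rfl fun k _ => ?_
    rw [sgn_eq_ite_mul (x k) (y k)]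
    simp only [hc, hε]; ring
  -- symmetrisation: `Σ_{i≠k} c_{ik} ε_k = Σ_{i≠k} c_{ik} ε_i`
  have hswap : ∑ i, ∑ k ∈ univ.erase i, c i k * ε k = ∑ i, ∑ k ∈ univ.erase i, c i k * ε i := by
    rw [Finset.sum_comm' (t' := univ) (s' := fun k => univ.erase k)]
    · exact Finset.sum_congr rfl fun k _ => Finset.sum_congr rfl fun i _ => by rw [hsymm]
    · intro i k
      simp only [Finset.mem_univ, true_and, and_true, Finset.mem_erase, ne_eq]
      exact ⟨fun h => fun h' => h h'.symm, fun h => fun h' => h h'.symm⟩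
  have h2 : 2 * ∑ i, ∑ k ∈ univ.erase i, c i k * ε k = ∑ i, ∑ k ∈ univ.erase i, c i k * (ε i + ε k) := by
    rw [two_mul]
    nth_rewrite 1 [hswap]
    rw [← Finset.sum_add_distrib]
    refine Finset.sum_congr rfl fun i _ => ?_
    rw [← Finset.sum_add_distrib]
    exact Finset.sum_congr rfl fun k _ => by ring
  -- `ε i + ε k = 2 [i,k ∈ Jᶜ] - 2 [i,k ∈ J]`
  set Jc : Finset (Fin N) := univ.filter (fun k : Fin N => x k = y k) with hJc
  set J : Finset (Fin N) := univ.filter (fun k : Fin N => x k ≠ y k) with hJ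
  have hεsum : ∀ i k, ε i + ε k =
      2 * (if i ∈ Jc then 1 else 0) * (if k ∈ Jc then 1 else 0) -
        2 * (if i ∈ J then 1 else 0) * (if k ∈ J then 1 else 0) := by
    intro i k
    simp only [hε, hJc, hJ, Finset.mem_filter, Finset.mem_univ, true_and, ne_eq]
    by_cases hi : x i = y i <;> by_cases hk : x k = y k <;> simp [hi, hk] <;> norm_num
  -- the two indicator-weighted double sums are sums over pairs inside `Jc` / `J`
  have hind : ∀ B : Finset (Fin N),
      ∑ i, ∑ k ∈ univ.erase i, c i k * ((if i ∈ B then (1 : ℝ) else 0) * (if k ∈ B then 1 else 0)) =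
        2 * ∑ S ∈ B.powersetCard 2, cubeFourierCoeff g S * walsh S x := by
    intro B
    rw [← sum_sum_erase_pair]
    rw [← Finset.sum_filter_add_sum_filter_not univ (fun i => i ∈ B)]
    have hz : ∑ i ∈ univ.filter (fun i => ¬ i ∈ B), ∑ k ∈ univ.erase i,
        c i k * ((if i ∈ B then (1 : ℝ) else 0) * (if k ∈ B then 1 else 0)) = 0 := by
      refine Finset.sum_eq_zero fun i hi => ?_
      rw [Finset.mem_filter] at hi
      refine Finset.sum_eq_zero fun k _ => ?_
      rw [if_neg hi.2]; ring
    rw [hz, add_zero, Finset.filter_mem_eq_inter, Finset.univ_inter]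
    refine Finset.sum_congr rfl fun i hi => ?_
    rw [if_pos hi]
    rw [← Finset.sum_filter_add_sum_filter_not (univ.erase i) (fun k => k ∈ B)]
    have hz' : ∑ k ∈ (univ.erase i).filter (fun k => ¬ k ∈ B), c i k * (1 * (if k ∈ B then (1 : ℝ) else 0)) = 0 := by
      refine Finset.sum_eq_zero fun k hk => ?_
      rw [Finset.mem_filter] at hk
      rw [if_neg hk.2]; ring
    rw [hz', add_zero]
    have hset : (univ.erase i).filter (fun k => k ∈ B) = B.erase i := by
      ext k; simp [Finset.mem_erase, and_comm]
    rw [hset]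
    refine Finset.sum_congr rfl fun k hk => ?_
    have hki : k ≠ i := (Finset.mem_erase.mp hk).1
    rw [if_pos (Finset.mem_erase.mp hk).2]
    simp only [hc]
    rw [walsh_pair hki.symm]; ring
  -- assemble
  have hmain : 2 * ∑ i, ∑ k ∈ univ.erase i, c i k * ε k =
      2 * (2 * ∑ S ∈ Jc.powersetCard 2, cubeFourierCoeff g S * walsh S x) -
        2 * (2 * ∑ S ∈ J.powersetCard 2, cubeFourierCoeff g S * walsh S x) := by
    rw [h2, ← hind Jc, ← hind J, Finset.mul_sum, Finset.mul_sum, ← Finset.sum_sub_distrib]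
    refine Finset.sum_congr rfl fun i _ => ?_
    rw [Finset.mul_sum, Finset.mul_sum, ← Finset.sum_sub_distrib]
    refine Finset.sum_congr rfl fun k _ => ?_
    rw [hεsum]; ring
  rw [hLHS]
  linarith

/-- **The decoupled (bilinear) level-2 form is bounded**: if the level-2 part of `g` is `L`-bounded in sup
norm then `|Σ_i Σ_{k≠i} ĝ({i,k}) χ_i(x) χ_k(y)| ≤ 4L` for all sign patterns `x, y`. [folklore] -/
theorem abs_bilinear_le {L : ℝ} {g : (Fin N → Bool) → ℝ}
    (hL : ∀ z : Fin N → Bool,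
      |∑ S ∈ univ.filter (fun S : Finset (Fin N) => S.card = 2), cubeFourierCoeff g S * walsh S z| ≤ L)
    (x y : Fin N → Bool) :
    |∑ i, ∑ k ∈ univ.erase i, cubeFourierCoeff g {i, k} * sgn (x i) * sgn (y k)| ≤ 4 * L := by
  rw [bilinear_eq]
  have h1 := abs_levelTwo_sum_subset_le hL (univ.filter (fun k : Fin N => x k = y k)) x
  have h2 := abs_levelTwo_sum_subset_le hL (univ.filter (fun k : Fin N => x k ≠ y k)) x
  calc |2 * ∑ S ∈ (univ.filter (fun k : Fin N => x k = y k)).powersetCard 2, cubeFourierCoeff g S * walsh S x -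
        2 * ∑ S ∈ (univ.filter (fun k : Fin N => x k ≠ y k)).powersetCard 2, cubeFourierCoeff g S * walsh S x|
      ≤ |2 * ∑ S ∈ (univ.filter (fun k : Fin N => x k = y k)).powersetCard 2, cubeFourierCoeff g S * walsh S x| +
        |2 * ∑ S ∈ (univ.filter (fun k : Fin N => x k ≠ y k)).powersetCard 2,
          cubeFourierCoeff g S * walsh S x| := abs_sub _ _
    _ ≤ 2 * L + 2 * L := by rw [abs_mul, abs_mul, abs_two]; gcongr
    _ = 4 * L := by ring

/-- **Row sums are uniformly bounded**: for every `u`, `Σ_i |Σ_{k≠i} ĝ({i,k}) χ_k(u)| ≤ 4L` (take `x` = the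
signs of the rows in `abs_bilinear_le`). [folklore] -/
theorem sum_abs_row_le {L : ℝ} {g : (Fin N → Bool) → ℝ}
    (hL : ∀ z : Fin N → Bool,
      |∑ S ∈ univ.filter (fun S : Finset (Fin N) => S.card = 2), cubeFourierCoeff g S * walsh S z| ≤ L)
    (u : Fin N → Bool) :
    ∑ i, |∑ k ∈ univ.erase i, cubeFourierCoeff g {i, k} * sgn (u k)| ≤ 4 * L := by
  set x : Fin N → Bool := fun i => decide (∑ k ∈ univ.erase i, cubeFourierCoeff g {i, k} * sgn (u k) < 0)
    with hx
  have h := abs_bilinear_le hL x u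
  have hrow : ∀ i, ∑ k ∈ univ.erase i, cubeFourierCoeff g {i, k} * sgn (x i) * sgn (u k) =
      |∑ k ∈ univ.erase i, cubeFourierCoeff g {i, k} * sgn (u k)| := by
    intro i
    have hfac : ∑ k ∈ univ.erase i, cubeFourierCoeff g {i, k} * sgn (x i) * sgn (u k) =
        sgn (x i) * ∑ k ∈ univ.erase i, cubeFourierCoeff g {i, k} * sgn (u k) := by
      rw [Finset.mul_sum]
      exact Finset.sum_congr rfl fun k _ => by ring
    rw [hfac]
    by_cases hlt : ∑ k ∈ univ.erase i, cubeFourierCoeff g {i, k} * sgn (u k) < 0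
    · have : x i = true := by simp only [hx]; exact decide_eq_true hlt
      rw [this, sgn_true, abs_of_neg hlt]; ring
    · have : x i = false := by simp only [hx]; exact decide_eq_false hlt
      rw [this, sgn_false, abs_of_nonneg (not_lt.mp hlt), one_mul]
  simp_rw [hrow] at h
  exact le_trans (le_abs_self _) h

end Summit.QuantumAdvantage.QuantumAdvantage.Theorems.SosSandwich.LevelTwoRung
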